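import Summits.Schanuel.Schanuel.Theorems.RootDecomp1KDarkKernel
import Summits.Schanuel.Schanuel.Theses.RootDecomp1K

/-!
# RootDecomp1KDarkStorey — §19 «DarkCarving» port, part 4/4 (lens 6, gen 10 = ROUND 5 theorem round of route-Schanuel-RootDecomp1K on A₄ʰ stmt-Schanuel-33363)

Mechanical port (census-1 gen 8; tools tools/build_dark.py over census/tools/gen7/portkit2.py) of §19 of HOME/decomp-schanuel-lens-6/g10/DarkCarving.lean
(sha256 8f91770b…, 9205 l; critic VERDICT 2026-08-30T15:10:09Z ACCEPTED — THEOREM ROUND, PATH T, census C-2) on top of the §17 wave Theorems/RootDecomp1KHyper01…19.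
This part: node lines 8046–9155 (9 declarations: hyperLiouvilleSchanuel_iff_live, weakMeasure_of_int_relation, weakMeasure_log_of_NW1996Thm1, darkWeakMeasure_of_NW1996Thm1, weakMeasure_exp_of_NW1996Thm1, hyperLiouvilleSchanuel_two_of_NW1996Thm1 …).
The node-local named fact `NW1996Thm1` is replaced by the registered Literature fact
`Literature.NumberTheory.Transcendental.NesterenkoWaldschmidt1996_thm_1` (token-identical body); statements and proofs
are otherwise the node's verbatim, in the wave namespace `Summit.Schanuel.Schanuel.Theorems.RootDecomp1KHyper` (sub-namespace `HyperCell`).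
`--supports stmt-Schanuel-33363` (A₄ʰ HyperLiouvilleSchanuel: levels n ≤ 2 decided mod NW96 Thm 1 alone). Sorry-free; standard axioms. Nothing here proves Schanuel; rung 0.
-/

set_option linter.dupNamespace false
set_option linter.unusedSectionVars false

noncomputable section

open Complex IntermediateField Filter Polynomial
open Literature.NumberTheory.Transcendental (NesterenkoWaldschmidt1996_thm_1)

namespace Summit.Schanuel.Schanuel.Theorems.RootDecomp1KHyper

variable {n K : ℕ}

namespace HyperCell

variable {n K : ℕ}

/-- §16b. Roots: a root within ‖A(w)‖^{1/N}, Gauss, Mahler: auxiliary statement `one_le_mahlerMeasure_map_of_ne_zero` (lens 6 gen 10 node, ported verbatim). -/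
private theorem one_le_mahlerMeasure_map_of_ne_zero {R : ℤ[X]} (hR : R ≠ 0) :
    1 ≤ (R.map (Int.castRingHom ℂ)).mahlerMeasure := by
  refine one_le_mahlerMeasure_of_one_le_norm_leadingCoeff ?_
  rw [Polynomial.leadingCoeff_map_of_injective (RingHom.injective_int _), eq_intCast,
    Complex.norm_intCast]
  exact_mod_cast Int.one_le_abs (Polynomial.leadingCoeff_ne_zero.mpr hR)

/-- §16b. Roots: a root within ‖A(w)‖^{1/N}, Gauss, Mahler: auxiliary statement `mahlerMeasure_le_of_dvd` (lens 6 gen 10 node, ported verbatim). -/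
private theorem mahlerMeasure_le_of_dvd {Q A : ℤ[X]} (hdvd : Q ∣ A) (hA : A ≠ 0) :
    (Q.map (Int.castRingHom ℂ)).mahlerMeasure ≤ (A.map (Int.castRingHom ℂ)).mahlerMeasure := by
  obtain ⟨R, rfl⟩ := hdvd
  have hR : R ≠ 0 := right_ne_zero_of_mul hA
  rw [Polynomial.map_mul, mahlerMeasure_mul]
  calc (Q.map (Int.castRingHom ℂ)).mahlerMeasure = (Q.map (Int.castRingHom ℂ)).mahlerMeasure * 1 :=
        (mul_one _).symm
    _ ≤ _ := mul_le_mul_of_nonneg_left (one_le_mahlerMeasure_map_of_ne_zero hR)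
        (mahlerMeasure_nonneg _)

/-- The round-4 pieces ARE the live items 33363 / 33364 (rev 5–8 typed them verbatim). -/
theorem hyperLiouvilleSchanuel_iff_live :
    HyperLiouvilleSchanuel ↔ Summit.Schanuel.Schanuel.Theses.RootDecomp1K.HyperLiouvilleSchanuel :=
  Iff.rfl

open Literature.NumberTheory.Transcendental in
/-- **The dark cell.**  A transcendental `t` with an integer relation `Σ_{k ≤ K} G_k(t) e^{kt} = 0`,
`G_K ≠ 0`, has a `WeakMeasure` (mod NW 1996 Theorem 1): `K ≥ 1` and `G_K(t) ≠ 0` by transcendence. -/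
theorem weakMeasure_of_int_relation (hNW : NesterenkoWaldschmidt1996_thm_1) {t : ℂ} (ht : Transcendental ℚ t)
    {K : ℕ} (G : Fin (K + 1) → ℤ[X]) (hGK : G (Fin.last K) ≠ 0)
    (hrel : ∑ k : Fin (K + 1), aeval t (G k) * cexp t ^ (k : ℕ) = 0) : WeakMeasure t := by
  -- `K ≥ 1`: a relation of degree `0` in `e^t` would make `t` algebraic
  have hK : 0 < K := by
    rcases Nat.eq_zero_or_pos K with h | h
    · exfalso
      subst h
      have h0 : aeval t (G 0) = 0 := by simpa using hrel
      have hG0 : G 0 ≠ 0 := by simpa using hGK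
      exact ht (isAlgebraic_of_aeval_int hG0 h0)
    · exact h
  have ht0 : t ≠ 0 := by
    rintro rfl; exact ht isAlgebraic_zero
  exact weakMeasure_of_int_relation' hNW ht0 hK G (fun h => ht (isAlgebraic_of_aeval_int hGK h))
    hrel

open Literature.NumberTheory.Transcendental in
/-- **The logarithm cell, free of Waldschmidt 1978 Cor. 3.7.**  A non-zero `λ` with `e^λ`
algebraic has a `WeakMeasure` (mod NW 1996 Theorem 1): the minimal relation of `e^λ` is an
integer relation `Σ g_k e^{kλ} = 0` with CONSTANT coefficients `G_k = g_k`, so the kernel applies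
verbatim (no transcendence of `λ` is presupposed — it follows). -/
theorem weakMeasure_log_of_NW1996Thm1 (hNW : NesterenkoWaldschmidt1996_thm_1) {lam : ℂ} (h0 : lam ≠ 0)
    (halg : IsAlgebraic ℚ (cexp lam)) : WeakMeasure lam := by
  obtain ⟨g, hgirr, hgdeg, hg⟩ := NesterenkoWaldschmidt1996.exists_irreducible_int_aeval_eq_zero halg
  refine weakMeasure_of_int_relation' hNW h0 hgdeg (fun k => C (g.coeff k)) ?_ ?_
  · rw [aeval_C, algebraMap_int_eq, eq_intCast, Fin.val_last, Int.cast_ne_zero]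
    exact leadingCoeff_ne_zero.mpr hgirr.ne_zero
  · have e : ∑ k : Fin (g.natDegree + 1), aeval lam (C (g.coeff k)) * cexp lam ^ (k : ℕ) =
        aeval (cexp lam) g := by
      rw [aeval_eq_sum_range,
        ← Fin.sum_univ_eq_sum_range (fun i => g.coeff i • cexp lam ^ i) (g.natDegree + 1)]
      refine Finset.sum_congr rfl fun k _ => ?_
      rw [aeval_C, algebraMap_int_eq, eq_intCast, zsmul_eq_mul]
    rw [e, hg]

open Literature.NumberTheory.Transcendental in
/-- **Round 5: the typed leaf `DarkWeakMeasure` of round 4 DECIDED mod NW 1996 Theorem 1.** -/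
theorem darkWeakMeasure_of_NW1996Thm1 (hNW : NesterenkoWaldschmidt1996_thm_1) : DarkWeakMeasure := by
  intro t ht _ hai
  obtain ⟨K, G, hGK, hrel⟩ := exists_int_relation ht hai
  exact weakMeasure_of_int_relation hNW ht G hGK hrel

open Literature.NumberTheory.Transcendental in
set_option maxHeartbeats 800000 in
/-- **The algebraic-exponent cell, free of Waldschmidt 1978 Cor. 3.9.**  For `β` algebraic and
non-zero, `e^β` has a `WeakMeasure` (mod NW 1996 Theorem 1): `|P(e^β)|` small puts a root `α` of an
irreducible factor `f ∣ P` within `|P(e^β)|^{1/deg P}` of `e^β`, `h(α) ≤ log M(f) ≤ log len P`,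
`[ℚ(α,β):ℚ] ≤ d · deg β`; Theorem 1 at `(θ, α, β) := (β, α, β)` — where `|θ − β| = 0` — gives
`|e^β − α| ≥ exp(−C_Φ (len P)²)`. -/
theorem weakMeasure_exp_of_NW1996Thm1 (hNW : NesterenkoWaldschmidt1996_thm_1) {β : ℂ} (hβalg : IsAlgebraic ℚ β)
    (hβ0 : β ≠ 0) : WeakMeasure (cexp β) := by
  classical
  -- constants of `β`: its minimal integer equation `g`, `M(g)`
  obtain ⟨g, hgirr, hgdeg, hgβ⟩ := NesterenkoWaldschmidt1996.exists_irreducible_int_aeval_eq_zero hβalg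
  have hg0 : g ≠ 0 := hgirr.ne_zero
  obtain ⟨Mg, hMgdef⟩ : ∃ M : ℝ, M = (g.map (Int.castRingHom ℂ)).mahlerMeasure := ⟨_, rfl⟩
  have hMg1 : 1 ≤ Mg := hMgdef ▸ one_le_mahlerMeasure_map_of_ne_zero hg0
  have hu0 : 0 < ‖cexp β‖ := norm_pos_iff.mpr (Complex.exp_ne_zero β)
  set δ : ℝ := min 1 (‖cexp β‖ / 2) with hδdef
  have hδ0 : 0 < δ := lt_min one_pos (half_pos hu0)
  have hδ1 : δ ≤ 1 := min_le_left _ _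
  have hδu : δ ≤ ‖cexp β‖ / 2 := min_le_right _ _
  set ℓt : ℝ := Real.log (Real.exp 1 * max 1 ‖β‖) with hℓtdef
  have hℓt : 0 ≤ ℓt := by
    rw [hℓtdef]
    refine Real.log_nonneg ?_
    have h1 : (1 : ℝ) ≤ Real.exp 1 := by linarith [Real.add_one_le_exp (1 : ℝ)]
    exact one_le_mul_of_one_le_of_one_le h1 (le_max_left _ _)
  set b : ℝ := Real.log Mg + 1 with hbdef
  have hb1 : 1 ≤ b := by rw [hbdef]; linarith only [Real.log_nonneg hMg1]
  have hb0 : 0 ≤ b := zero_le_one.trans hb1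
  intro d
  -- the constants for degree `d`
  set ε0 : ℝ := δ ^ d with hε0def
  have hε0pos : 0 < ε0 := pow_pos hδ0 d
  have hε01 : ε0 ≤ 1 := pow_le_one₀ hδ0.le hδ1
  have hlogε0 : Real.log ε0 ≤ 0 := Real.log_nonpos hε0pos.le hε01
  set D0 : ℝ := ((d * g.natDegree : ℕ) : ℝ) with hD0def
  have hD0 : 0 ≤ D0 := Nat.cast_nonneg _
  have hlogD0 : 0 ≤ Real.log D0 := Real.log_natCast_nonneg _
  have hlogD02 : 0 ≤ Real.log (D0 + 2) := Real.log_nonneg (by linarith only [hD0])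
  set F1 : ℝ := b + 2 + 4 * Real.log D0 + 2 * ℓt + 10 with hF1def
  have hF1 : 0 ≤ F1 := by rw [hF1def]; positivity
  set F2 : ℝ := 2 * D0 + 2 * Real.exp 1 * ‖β‖ + 6 with hF2def
  have hF2 : 0 ≤ F2 := by rw [hF2def]; positivity
  set F3 : ℝ := 33 / 10 * D0 * Real.log (D0 + 2) + 1 with hF3def
  have hF3 : 0 ≤ F3 := by rw [hF3def]; positivity
  set CΦ : ℝ := 211 * D0 * F1 * F2 * F3 with hCΦdef
  have hCΦ : 0 ≤ CΦ := by rw [hCΦdef]; positivity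
  set Cw : ℝ := d * CΦ - Real.log ε0 + 1 with hCdef
  have hCd : 0 ≤ (d : ℝ) * CΦ := by positivity
  have hC1 : 1 - Real.log ε0 ≤ Cw := by rw [hCdef]; linarith only [hCd]
  have hCpos : 0 < Cw := by linarith only [hC1, hlogε0]
  refine ⟨Cw, 2, hCpos, fun P hP0 hPd => ?_⟩
  set Λ : ℝ := ((len P : ℤ) : ℝ) with hΛdef
  have hΛ1 : 1 ≤ Λ := by rw [hΛdef]; exact_mod_cast one_le_len hP0
  have hΛ0 : 0 < Λ := zero_lt_one.trans_le hΛ1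
  have hΛ2 : 1 ≤ Λ ^ 2 := one_le_pow₀ hΛ1
  set ε : ℝ := ‖aeval (cexp β) P‖ with hεdef
  by_cases hsmall : ε < ε0
  swap
  · have hge : ε0 ≤ ε := not_lt.mp hsmall
    calc Real.exp (-(Cw * Λ ^ 2)) ≤ Real.exp (-Cw) := by
          rw [Real.exp_le_exp]
          have : Cw * 1 ≤ Cw * Λ ^ 2 := mul_le_mul_of_nonneg_left hΛ2 hCpos.le
          linarith only [this]
      _ ≤ Real.exp (Real.log ε0) := by rw [Real.exp_le_exp]; linarith only [hC1]
      _ = ε0 := Real.exp_log hε0pos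
      _ ≤ ε := hge
  -- the small range: `P` is non-constant
  have hPdeg : 0 < P.natDegree := by
    by_contra h
    have h0 : P.natDegree = 0 := by omega
    have hPC : P = C (P.coeff 0) := eq_C_of_natDegree_eq_zero h0
    have hc0 : P.coeff 0 ≠ 0 := by
      intro hc; apply hP0; rw [hPC, hc, C_0]
    have h1 : (1 : ℝ) ≤ ε := by
      rw [hεdef, hPC, aeval_C, algebraMap_int_eq, eq_intCast, Complex.norm_intCast]
      exact_mod_cast Int.one_le_abs hc0
    linarith only [h1, hsmall, hε01]
  -- a root `α` of `P` near `e^β`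
  obtain ⟨α, hαP, hαclose⟩ := exists_root_int_pow_le P hPdeg (cexp β)
  set ρ : ℝ := ‖cexp β - α‖ with hρdef
  have hρ0 : 0 ≤ ρ := norm_nonneg _
  have hρδ : ρ < δ := by
    have h1 : ρ ^ P.natDegree < δ ^ P.natDegree :=
      calc ρ ^ P.natDegree ≤ ε := hαclose
        _ < ε0 := hsmall
        _ = δ ^ d := rfl
        _ ≤ δ ^ P.natDegree := pow_le_pow_of_le_one hδ0.le hδ1 hPd
    exact lt_of_pow_lt_pow_left₀ _ hδ0.le h1
  have hρ1 : ρ ≤ 1 := hρδ.le.trans hδ1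
  have hα0 : α ≠ 0 := by
    rintro rfl
    have : ‖cexp β‖ < δ := by simpa [hρdef] using hρδ
    linarith only [this, hδu, hu0]
  -- the irreducible factor `f` of `P` at `α`; degrees and heights
  have hαalgP : IsAlgebraic ℚ α := isAlgebraic_of_aeval_int hP0 hαP
  obtain ⟨f, hfirr, hfdeg, hαf⟩ := NesterenkoWaldschmidt1996.exists_irreducible_int_aeval_eq_zero hαalgP
  have hf0 : f ≠ 0 := hfirr.ne_zero
  have hfP : f ∣ P := dvd_of_irreducible_of_common_root hfirr hfdeg hαf hαP
  have hnP : f.natDegree ≤ P.natDegree := natDegree_le_of_dvd hfP hP0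
  have hnd : f.natDegree ≤ d := hnP.trans hPd
  obtain ⟨hαalg, hβalg', hD1, hDle, hhα, hhβ⟩ := pair_bounds g hgirr hgdeg hgβ f hf0 hαf
  obtain ⟨D, hDdef⟩ : ∃ D : ℕ, Module.finrank ℚ (IntermediateField.adjoin ℚ ({α, β} : Set ℂ)) = D :=
    ⟨_, rfl⟩
  rw [hDdef] at hD1 hDle
  have hD1' : (1 : ℝ) ≤ D := by exact_mod_cast hD1
  have hD0' : (0 : ℝ) < D := zero_lt_one.trans_le hD1'
  have hDD0 : (D : ℝ) ≤ D0 := by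
    rw [hD0def]
    have h1 : D ≤ d * g.natDegree := hDle.trans (Nat.mul_le_mul_right _ hnd)
    exact_mod_cast h1
  have hlogD : 0 ≤ Real.log (D : ℝ) := Real.log_nonneg hD1'
  have hlogDD0 : Real.log (D : ℝ) ≤ Real.log D0 := Real.log_le_log hD0' hDD0
  have hlogD2 : Real.log ((D : ℝ) + 2) ≤ Real.log (D0 + 2) :=
    Real.log_le_log (by positivity) (by linarith only [hDD0])
  set Mf : ℝ := (f.map (Int.castRingHom ℂ)).mahlerMeasure with hMfdef
  have hMf1 : 1 ≤ Mf := one_le_mahlerMeasure_map_of_ne_zero hf0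
  have hMf0 : 0 ≤ Mf := zero_le_one.trans hMf1
  have hMfΛ : Mf ≤ Λ := by
    refine (mahlerMeasure_le_of_dvd hfP hP0).trans ((mahlerMeasure_map_le_sum le_rfl).trans ?_)
    rw [hΛdef, len]; push_cast; exact le_rfl
  set a : ℝ := Real.log Mf + 1 with hadef
  have ha1' : 1 ≤ a := by rw [hadef]; linarith only [Real.log_nonneg hMf1]
  have ha0 : 0 < a := zero_lt_one.trans_le ha1'
  have haΛ : a ≤ 2 * Λ := by
    have h1 : Real.log Mf ≤ Real.log Λ := Real.log_le_log (zero_lt_one.trans_le hMf1) hMfΛ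
    have h2 : Real.log Λ ≤ Λ - 1 := Real.log_le_sub_one_of_pos hΛ0
    rw [hadef]; linarith only [h1, h2, hΛ1]
  have hloga : Real.log a ≤ a := (Real.log_le_sub_one_of_pos ha0).trans (by linarith only [])
  -- the hypotheses of Theorem 1
  have hA : max (weilHeight₁ (IntermediateField.adjoin ℚ ({α, β} : Set ℂ)) (fun _ : Unit => α))
      (1 / (Module.finrank ℚ (IntermediateField.adjoin ℚ ({α, β} : Set ℂ)) : ℝ)) ≤
      Real.log (Real.exp a) := by
    rw [Real.log_exp, hDdef]
    refine max_le (hhα.trans (by rw [hadef]; exact le_add_of_nonneg_right zero_le_one)) ?_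
    calc (1 : ℝ) / D ≤ 1 := by rw [div_le_one hD0']; exact hD1'
      _ ≤ a := ha1'
  have hB : weilHeight₁ (IntermediateField.adjoin ℚ ({α, β} : Set ℂ)) (fun _ : Unit => β) ≤
      Real.log (Real.exp b) := by
    rw [Real.log_exp, hbdef]
    refine hhβ.trans ?_
    rw [hMgdef]; exact le_add_of_nonneg_right zero_le_one
  -- Theorem 1 at `θ = β`
  have key : Real.exp (-(211 * (D : ℝ) * (b + Real.log a + 4 * Real.log (D : ℝ) + 2 * ℓt + 10) *
      ((D : ℝ) * a + 2 * Real.exp 1 * ‖β‖ + 6 * 1) *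
      ((33 / 10 : ℝ) * (D : ℝ) * Real.log ((D : ℝ) + 2) + 1) / 1 ^ 2)) ≤
      ‖cexp β - α‖ + ‖β - β‖ := by
    have h := hNW β α β (Real.exp a) (Real.exp b) (Real.exp 1) hβ0 hα0 hβ0 hαalg hβalg'
      (Real.exp_pos a) (Real.exp_pos b) le_rfl hA hB
    rw [Real.log_exp, Real.log_exp, Real.log_exp, hDdef] at h
    exact h
  set Φ : ℝ := 211 * (D : ℝ) * (b + Real.log a + 4 * Real.log (D : ℝ) + 2 * ℓt + 10) *
      ((D : ℝ) * a + 2 * Real.exp 1 * ‖β‖ + 6 * 1) *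
      ((33 / 10 : ℝ) * (D : ℝ) * Real.log ((D : ℝ) + 2) + 1) / 1 ^ 2 with hΦdef
  have hf1le : b + Real.log a + 4 * Real.log (D : ℝ) + 2 * ℓt + 10 ≤ F1 * Λ := by
    have h0 : b * 1 ≤ b * Λ := mul_le_mul_of_nonneg_left hΛ1 hb0
    have h1 : Real.log a ≤ 2 * Λ := hloga.trans haΛ
    have h2 : 4 * Real.log (D : ℝ) * 1 ≤ 4 * Real.log D0 * Λ :=
      mul_le_mul (by linarith only [hlogDD0]) hΛ1 zero_le_one (by positivity)
    have h3 : 2 * ℓt * 1 ≤ 2 * ℓt * Λ := mul_le_mul_of_nonneg_left hΛ1 (by positivity)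
    have e : F1 * Λ = b * Λ + 2 * Λ + 4 * Real.log D0 * Λ + 2 * ℓt * Λ + 10 * Λ := by
      rw [hF1def]; ring
    rw [e]
    linarith only [h0, h1, h2, h3, hΛ1]
  have hf1nn : 0 ≤ b + Real.log a + 4 * Real.log (D : ℝ) + 2 * ℓt + 10 := by
    have : 0 ≤ Real.log a := Real.log_nonneg ha1'
    positivity
  have hf2le : (D : ℝ) * a + 2 * Real.exp 1 * ‖β‖ + 6 * 1 ≤ F2 * Λ := by
    have h1 : (D : ℝ) * a ≤ D0 * (2 * Λ) := mul_le_mul hDD0 haΛ ha0.le hD0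
    have h2 : (2 * Real.exp 1 * ‖β‖ + 6) * 1 ≤ (2 * Real.exp 1 * ‖β‖ + 6) * Λ :=
      mul_le_mul_of_nonneg_left hΛ1 (by positivity)
    have e : F2 * Λ = D0 * (2 * Λ) + (2 * Real.exp 1 * ‖β‖ + 6) * Λ := by rw [hF2def]; ring
    rw [e]
    linarith only [h1, h2]
  have hf2nn : 0 ≤ (D : ℝ) * a + 2 * Real.exp 1 * ‖β‖ + 6 * 1 := by positivity
  have hf3le : (33 / 10 : ℝ) * (D : ℝ) * Real.log ((D : ℝ) + 2) + 1 ≤ F3 := by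
    rw [hF3def]
    have : (33 / 10 : ℝ) * (D : ℝ) * Real.log ((D : ℝ) + 2) ≤ 33 / 10 * D0 * Real.log (D0 + 2) :=
      mul_le_mul (mul_le_mul_of_nonneg_left hDD0 (by norm_num)) hlogD2
        (Real.log_nonneg (by linarith only [hD1'])) (by positivity)
    linarith only [this]
  have hf3nn : 0 ≤ (33 / 10 : ℝ) * (D : ℝ) * Real.log ((D : ℝ) + 2) + 1 := by
    have : 0 ≤ Real.log ((D : ℝ) + 2) := Real.log_nonneg (by linarith only [hD1'])
    positivity
  have hΦle : Φ ≤ CΦ * Λ ^ 2 := by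
    rw [hΦdef, hCΦdef, one_pow, div_one]
    calc 211 * (D : ℝ) * (b + Real.log a + 4 * Real.log (D : ℝ) + 2 * ℓt + 10) *
          ((D : ℝ) * a + 2 * Real.exp 1 * ‖β‖ + 6 * 1) *
          ((33 / 10 : ℝ) * (D : ℝ) * Real.log ((D : ℝ) + 2) + 1)
        ≤ 211 * D0 * (F1 * Λ) * (F2 * Λ) * F3 := by
          refine mul_le_mul (mul_le_mul (mul_le_mul (mul_le_mul_of_nonneg_left hDD0 (by norm_num))
            hf1le hf1nn (by positivity)) hf2le hf2nn (by positivity)) hf3le hf3nn (by positivity)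
      _ = 211 * D0 * F1 * F2 * F3 * Λ ^ 2 := by ring
  have hΦ0 : 0 ≤ Φ := by rw [hΦdef]; positivity
  -- endgame: `ρ ≥ exp(−Φ)`, `ε ≥ ρ^d`
  set η : ℝ := Real.exp (-Φ) with hηdef
  have hη0 : 0 < η := Real.exp_pos _
  have hkey : η ≤ ρ := by
    have h := key
    rwa [sub_self, norm_zero, add_zero] at h
  have hεlb : η ^ d ≤ ε :=
    calc η ^ d ≤ ρ ^ d := pow_le_pow_left₀ hη0.le hkey d
      _ ≤ ρ ^ P.natDegree := pow_le_pow_of_le_one hρ0 hρ1 hPd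
      _ ≤ ε := hαclose
  refine le_trans ?_ hεlb
  rw [← Real.exp_log (pow_pos hη0 d), Real.exp_le_exp, Real.log_pow, hηdef, Real.log_exp]
  have h1 : (d : ℝ) * Φ ≤ d * (CΦ * Λ ^ 2) := mul_le_mul_of_nonneg_left hΦle (Nat.cast_nonneg d)
  have h4 : 0 ≤ (-Real.log ε0 + 1) * Λ ^ 2 := mul_nonneg (by linarith only [hlogε0]) (by positivity)
  have hCΛ : Cw * Λ ^ 2 = d * (CΦ * Λ ^ 2) + (-Real.log ε0 + 1) * Λ ^ 2 := by rw [hCdef]; ring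
  linarith only [hCΛ, h1, h4]

open Literature.NumberTheory.Transcendental in
/-- **Level 2 of A₄ʰ, round 5, modulo NW 1996 Theorem 1 ALONE** (`h1`, printed): the four cells
of a ℚ-free hyper-Liouville pair `z` by the nature of `z 0` — algebraic (weak measure of `e^{z 0}`,
`weakMeasure_exp_of_NW1996Thm1`; no `hW`), a non-zero logarithm of an algebraic number
(`weakMeasure_log_of_NW1996Thm1`; no `hlm`), free, DARK (`darkWeakMeasure_of_NW1996Thm1`; no `hD`,
no `hX`) — three of them through the ONE round-4 master cell `sb_two_of_hyperLinLiouville_of_weakMeasure`. -/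
theorem hyperLiouvilleSchanuel_two_of_NW1996Thm1 (h1 : NesterenkoWaldschmidt1996_thm_1)
    (z : Fin 2 → ℂ) (hz : LinearIndependent ℚ z) (hH : HyperLinLiouville z) : SB 2 z := by
  by_cases hβ : IsAlgebraic ℚ (z 0)
  · exact sb_two_of_hyperLinLiouville_of_weakMeasure
      (weakMeasure_exp_of_NW1996Thm1 h1 hβ (hz.ne_zero 0)) hz hH
      (mem_adjoin_SFset_I (Or.inr ⟨0, rfl⟩))
  by_cases hα : IsAlgebraic ℚ (cexp (z 0))
  · exact sb_two_of_hyperLinLiouville_of_weakMeasure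
      (weakMeasure_log_of_NW1996Thm1 h1 (hz.ne_zero 0) hα) hz hH
      (mem_adjoin_SFset_I (Or.inl ⟨0, rfl⟩))
  by_cases hai : AlgebraicIndependent ℚ ![z 0, cexp (z 0)]
  · exact sb_two_of_algebraicIndependent_exp 0 hai
  exact sb_two_of_hyperLinLiouville_of_weakMeasure
    (darkWeakMeasure_of_NW1996Thm1 h1 (z 0) hβ hα hai) hz hH (mem_adjoin_SFset_I (Or.inl ⟨0, rfl⟩))

open Literature.NumberTheory.Transcendental in
/-- **A₄ʰ at every level ≤ 2, round 5** (mod NW 1996 Theorem 1 alone). -/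
theorem hyperLiouvilleSchanuel_le_two_of_NW1996Thm1 (h1 : NesterenkoWaldschmidt1996_thm_1) {n : ℕ}
    (hn : n ≤ 2) (z : Fin n → ℂ) (hz : LinearIndependent ℚ z) (hH : HyperLinLiouville z) :
    SB n z := by
  rcases n with _ | _ | _ | n
  · exact sb_zero z
  · exact absurd hH (not_hyperLinLiouville_one hz)
  · exact hyperLiouvilleSchanuel_two_of_NW1996Thm1 h1 z hz hH
  · omega

open Literature.NumberTheory.Transcendental in
/-- The same over the LIVE crux decl `RootDecomp1K.HyperLiouvilleSchanuel` (stmt-Schanuel-33363),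
restricted to `n ≤ 2`: its hypotheses and conclusion, verbatim. -/
theorem hyperLiouvilleSchanuel_live_le_two_of_NW1996Thm1 (h1 : NesterenkoWaldschmidt1996_thm_1) :
    ∀ (n : ℕ) (z : Fin n → ℂ), n ≤ 2 → LinearIndependent ℚ z →
      (∀ m : ℕ, ∃ h : Fin n → ℤ, h ≠ 0 ∧
        ‖∑ i, (h i : ℂ) * z i‖ < Real.exp (-((1 + ∑ i, (|h i| : ℝ)) ^ m))) →
      (n : Cardinal) ≤ Algebra.trdeg ℚ
        ↥(IntermediateField.adjoin ℚ (Set.range z ∪ Set.range (Complex.exp ∘ z))) :=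
  fun _ z hn hz hH => hyperLiouvilleSchanuel_le_two_of_NW1996Thm1 h1 hn z hz hH

open Literature.NumberTheory.Transcendental in
/-- Mod Theorem 1, the LIVE item 33363 IS its storey `n ≥ 3` (levels ≤ 2 are theorems). -/
theorem hyperLiouvilleSchanuel_live_of_three_le (h1 : NesterenkoWaldschmidt1996_thm_1)
    (h3 : ∀ (n : ℕ) (z : Fin n → ℂ), 3 ≤ n → LinearIndependent ℚ z → HyperLinLiouville z → SB n z) :
    Summit.Schanuel.Schanuel.Theses.RootDecomp1K.HyperLiouvilleSchanuel := by
  rw [← hyperLiouvilleSchanuel_iff_live]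
  intro n z hz hH
  rcases le_or_gt n 2 with hn | hn
  · exact hyperLiouvilleSchanuel_le_two_of_NW1996Thm1 h1 hn z hz hH
  · exact h3 n z hn hz hH

end HyperCell

end Summit.Schanuel.Schanuel.Theorems.RootDecomp1KHyper
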